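import Mathlib.Analysis.MeanInequalities
import HarnessLib

/-!
# Bennett's inequality: `‖(A ⊗ B) R‖_q ≤ ‖A‖_{p→q} ‖B‖_{p→q} ‖R‖_p` for `p ≤ q`

For nonnegative matrices `A : ι → κ → ℝ≥0`, `B : ι' → κ' → ℝ≥0` and real exponents `0 < p ≤ q`,
any constants `K_A`, `K_B` bounding the `ℓ^p → ℓ^q` action of `A` and `B` on nonnegative vectors
(`‖A c‖_q ≤ K_A ‖c‖_p` for all `c ≥ 0`, similarly for `B`) bound the tensor product:
`‖(A ⊗ B) R‖_q ≤ K_A K_B ‖R‖_p` for every nonnegative `R : κ × κ' → ℝ≥0` (`bennett_tensor_le`;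
the square `B ⊗ B` is `bennett_tensor_sq_le`). This is the upper-bound half of G. Bennett's
multiplicativity theorem `‖A ⊗ B‖_{p→q} = ‖A‖_{p→q} ‖B‖_{p→q}` (`p ≤ q`), proved by Bennett's
three-line argument — the norm bound for `A` block by block, Minkowski's inequality in `ℓ^{q/p}`
(`Lp_finset_sum_le`, finitely many summands), and the norm bound for `B` row by row — exactly as
reproduced in Galanis–Štefankovič–Vigoda (JACM 2015), proof of Lemma 3.2, where it is the key to
the second-moment analysis of spin systems on random bipartite regular graphs (their eq. (13)).

Design: the statement is in "hypothesis form" (ANY admissible constants `K_A`, `K_B`), which is what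
applications use and avoids introducing the operator norm as a supremum; for nonnegative matrices
the supremum over nonnegative vectors is the operator norm, so nothing is lost. Not here: the
equality (lower bound `≥`, from `R = c ⊗ c'`), and the equality-case analysis of GŠV Lemma 3.2.

## References
* G. Bennett, *Schur multipliers*, Duke Math. J. 44 (1977), 603–639 — the multiplicativity theorem.
* A. Galanis, D. Štefankovič, E. Vigoda, *Inapproximability for antiferromagnetic spin systems in
  the tree non-uniqueness region*, J. ACM 62 (2015), §3.3 eq. (13) and the proof of Lemma 3.2.
-/

namespace Literature.Analysis.Matrix

open NNReal Finset

variable {ι κ ι' κ' : Type*} [Fintype ι] [Fintype κ] [Fintype ι'] [Fintype κ']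

/-- **Minkowski's inequality for finitely many summands** (`ℓ^r`, `r ≥ 1`, nonnegative entries):
`(Σ_k (Σ_{j∈s} a_j(k))^r)^{1/r} ≤ Σ_{j∈s} (Σ_k a_j(k)^r)^{1/r}`. [folklore] -/
theorem Lp_finset_sum_le {J : Type*} (s : Finset J) (a : J → ι → ℝ≥0) {r : ℝ} (hr : 1 ≤ r) :
    (∑ k, (∑ j ∈ s, a j k) ^ r) ^ (1 / r) ≤ ∑ j ∈ s, (∑ k, a j k ^ r) ^ (1 / r) := by
  classical
  induction s using Finset.induction_on with
  | empty =>
    have hr0 : r ≠ 0 := by linarith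
    simp only [Finset.sum_empty, NNReal.zero_rpow hr0, Finset.sum_const_zero,
      NNReal.zero_rpow (one_div_ne_zero hr0), le_refl]
  | insert j s hj ih =>
    rw [Finset.sum_insert hj]
    calc (∑ k, (∑ i ∈ insert j s, a i k) ^ r) ^ (1 / r)
        = (∑ k, (a j k + ∑ i ∈ s, a i k) ^ r) ^ (1 / r) := by
          simp only [Finset.sum_insert hj]
      _ ≤ (∑ k, a j k ^ r) ^ (1 / r) + (∑ k, (∑ i ∈ s, a i k) ^ r) ^ (1 / r) :=
          NNReal.Lp_add_le univ _ _ hr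
      _ ≤ (∑ k, a j k ^ r) ^ (1 / r) + ∑ i ∈ s, (∑ k, a i k ^ r) ^ (1 / r) :=
          add_le_add le_rfl ih

/-- From `X^{1/q} ≤ Z` conclude `X ≤ Z^q` (`q > 0`), in `ℝ≥0`. [folklore] -/
theorem le_rpow_of_rpow_one_div_le {X Z : ℝ≥0} {q : ℝ} (hq : 0 < q) (h : X ^ (1 / q) ≤ Z) :
    X ≤ Z ^ q := by
  have := NNReal.rpow_le_rpow h hq.le
  rwa [NNReal.rpow_self_rpow_inv hq.ne'] at this

/-- **Bennett's inequality** (upper bound, two matrices): if `‖A c‖_q ≤ K_A ‖c‖_p` and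
`‖B c‖_q ≤ K_B ‖c‖_p` for all nonnegative vectors `c`, with `0 < p ≤ q`, then
`‖(A ⊗ B) R‖_q ≤ K_A K_B ‖R‖_p` for every nonnegative `R`, where
`((A ⊗ B) R)(i,k) = Σ_{j,l} A_{ij} B_{kl} R_{jl}`.
[cite: GalanisStefankovicVigoda2015, §3.3 eq. (13) and proof of Lemma 3.2 (after Bennett 1977)] -/
theorem bennett_tensor_le (A : ι → κ → ℝ≥0) (B : ι' → κ' → ℝ≥0) {p q : ℝ} (hp : 0 < p)
    (hpq : p ≤ q) (KA KB : ℝ≥0)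
    (hA : ∀ c : κ → ℝ≥0, (∑ i, (∑ j, A i j * c j) ^ q) ^ (1 / q) ≤ KA * (∑ j, c j ^ p) ^ (1 / p))
    (hB : ∀ c : κ' → ℝ≥0, (∑ i, (∑ j, B i j * c j) ^ q) ^ (1 / q) ≤ KB * (∑ j, c j ^ p) ^ (1 / p))
    (R : κ → κ' → ℝ≥0) :
    (∑ ik : ι × ι', (∑ jl : κ × κ', A ik.1 jl.1 * B ik.2 jl.2 * R jl.1 jl.2) ^ q) ^ (1 / q) ≤
      KA * KB * (∑ jl : κ × κ', R jl.1 jl.2 ^ p) ^ (1 / p) := by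
  have hq : 0 < q := hp.trans_le hpq
  have hp0 : p ≠ 0 := hp.ne'
  have hq0 : q ≠ 0 := hq.ne'
  -- the exponent `r = q/p ≥ 1` of the Minkowski step
  set r : ℝ := q / p with hr
  have hr1 : 1 ≤ r := by rw [hr, le_div_iff₀ hp, one_mul]; exact hpq
  have hr0 : 0 < r := lt_of_lt_of_le one_pos hr1
  -- `u k j = Σ_l B_{kl} R_{jl}`: the `B`-image of the `j`-th row of `R`
  set u : ι' → κ → ℝ≥0 := fun k j => ∑ l, B k l * R j l with hu
  have hinner : ∀ (i : ι) (k : ι'),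
      ∑ jl : κ × κ', A i jl.1 * B k jl.2 * R jl.1 jl.2 = ∑ j, A i j * u k j := by
    intro i k
    rw [Fintype.sum_prod_type]
    refine Finset.sum_congr rfl fun j _ => ?_
    rw [hu, Finset.mul_sum]
    refine Finset.sum_congr rfl fun l _ => ?_
    ring
  -- total mass `T = Σ_{j,l} R_{jl}^p`
  set T : ℝ≥0 := ∑ jl : κ × κ', R jl.1 jl.2 ^ p with hT
  have hT' : T = ∑ j, ∑ l, R j l ^ p := by rw [hT, Fintype.sum_prod_type]
  -- Step 3 (norm bound for `B`, row by row): `Σ_k u_k(j)^q ≤ K_B^q (Σ_l R_{jl}^p)^{q/p}`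
  have h3 : ∀ j : κ, ∑ k, u k j ^ q ≤ KB ^ q * (∑ l, R j l ^ p) ^ r := by
    intro j
    have h := le_rpow_of_rpow_one_div_le hq (hB (R j))
    rw [NNReal.mul_rpow, ← NNReal.rpow_mul, one_div_mul_eq_div] at h
    exact h
  -- hence `(Σ_k u_k(j)^q)^{1/r} ≤ K_B^p Σ_l R_{jl}^p`
  have h3' : ∀ j : κ, (∑ k, u k j ^ q) ^ (1 / r) ≤ KB ^ p * ∑ l, R j l ^ p := by
    intro j
    have h := NNReal.rpow_le_rpow (h3 j) (one_div_pos.2 hr0).le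
    refine h.trans (le_of_eq ?_)
    rw [NNReal.mul_rpow, ← NNReal.rpow_mul, ← NNReal.rpow_mul, mul_one_div_cancel hr0.ne',
      NNReal.rpow_one, hr]
    congr 1
    rw [show q * (1 / (q / p)) = p by field_simp]
  -- Step 2 (Minkowski in `ℓ^r`): `Σ_k (Σ_j u_k(j)^p)^r ≤ (K_B^p T)^r`
  have h2 : ∑ k, (∑ j, u k j ^ p) ^ r ≤ (KB ^ p * T) ^ r := by
    have hM := Lp_finset_sum_le (univ : Finset κ) (fun j k => u k j ^ p) hr1
    have hM' := le_rpow_of_rpow_one_div_le hr0 hM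
    refine hM'.trans (NNReal.rpow_le_rpow ?_ hr0.le)
    calc ∑ j, (∑ k, (u k j ^ p) ^ r) ^ (1 / r) = ∑ j, (∑ k, u k j ^ q) ^ (1 / r) := by
          refine Finset.sum_congr rfl fun j _ => ?_
          congr 1
          refine Finset.sum_congr rfl fun k _ => ?_
          rw [← NNReal.rpow_mul, hr, mul_div_cancel₀ _ hp0]
      _ ≤ ∑ j, KB ^ p * ∑ l, R j l ^ p := Finset.sum_le_sum fun j _ => h3' j
      _ = KB ^ p * T := by rw [← Finset.mul_sum, hT']
  -- Step 1 (norm bound for `A`, block by block): `Σ_i (Σ_j A_{ij} u_k(j))^q ≤ K_A^q (Σ_j u_k(j)^p)^r`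
  have h1 : ∀ k : ι', ∑ i, (∑ j, A i j * u k j) ^ q ≤ KA ^ q * (∑ j, u k j ^ p) ^ r := by
    intro k
    have h := le_rpow_of_rpow_one_div_le hq (hA (u k))
    rw [NNReal.mul_rpow, ← NNReal.rpow_mul, one_div_mul_eq_div] at h
    exact h
  -- assemble: `S = Σ_{i,k} (…)^q ≤ K_A^q K_B^q T^r`
  have hS : ∑ ik : ι × ι', (∑ jl : κ × κ', A ik.1 jl.1 * B ik.2 jl.2 * R jl.1 jl.2) ^ q ≤
      KA ^ q * (KB ^ q * T ^ r) := by
    calc ∑ ik : ι × ι', (∑ jl : κ × κ', A ik.1 jl.1 * B ik.2 jl.2 * R jl.1 jl.2) ^ q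
        = ∑ k, ∑ i, (∑ j, A i j * u k j) ^ q := by
          rw [Fintype.sum_prod_type, Finset.sum_comm]
          refine Finset.sum_congr rfl fun k _ => Finset.sum_congr rfl fun i _ => ?_
          rw [hinner]
      _ ≤ ∑ k, KA ^ q * (∑ j, u k j ^ p) ^ r := Finset.sum_le_sum fun k _ => h1 k
      _ = KA ^ q * ∑ k, (∑ j, u k j ^ p) ^ r := by rw [Finset.mul_sum]
      _ ≤ KA ^ q * (KB ^ p * T) ^ r := by gcongr
      _ = KA ^ q * (KB ^ q * T ^ r) := by
          rw [NNReal.mul_rpow, ← NNReal.rpow_mul, hr, mul_div_cancel₀ _ hp0]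
  -- take `q`-th roots
  have hroot := NNReal.rpow_le_rpow hS (one_div_pos.2 hq).le
  refine hroot.trans (le_of_eq ?_)
  rw [NNReal.mul_rpow, NNReal.mul_rpow, ← NNReal.rpow_mul, ← NNReal.rpow_mul, ← NNReal.rpow_mul,
    mul_one_div_cancel hq0, NNReal.rpow_one, NNReal.rpow_one, hr,
    show q / p * (1 / q) = 1 / p by field_simp, mul_assoc]

/-- **Bennett's inequality for the tensor square**: `‖(B ⊗ B) R‖_q ≤ K² ‖R‖_p` whenever
`‖B c‖_q ≤ K ‖c‖_p` for all nonnegative `c` and `0 < p ≤ q` — the form used for the second moment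
of a spin system (interaction matrix `B ⊗ B` of the paired-spin system).
[cite: GalanisStefankovicVigoda2015, §3.3 eq. (13)] -/
theorem bennett_tensor_sq_le (B : ι → κ → ℝ≥0) {p q : ℝ} (hp : 0 < p) (hpq : p ≤ q) (K : ℝ≥0)
    (hB : ∀ c : κ → ℝ≥0, (∑ i, (∑ j, B i j * c j) ^ q) ^ (1 / q) ≤ K * (∑ j, c j ^ p) ^ (1 / p))
    (R : κ → κ → ℝ≥0) :
    (∑ ik : ι × ι, (∑ jl : κ × κ, B ik.1 jl.1 * B ik.2 jl.2 * R jl.1 jl.2) ^ q) ^ (1 / q) ≤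
      K ^ 2 * (∑ jl : κ × κ, R jl.1 jl.2 ^ p) ^ (1 / p) := by
  rw [sq]
  exact bennett_tensor_le B B hp hpq K K hB hB R

end Literature.Analysis.Matrix
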